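import Summits.CriticalPhenomena.PercolationContinuityZ3.Theorems.PercNearOneGluingNoHeavyLowerTailKnQuestion8CoefficientwiseCoreClassKernelMixBundleCanonicalSlab
import Summits.CriticalPhenomena.PercolationContinuityZ3.Theorems.PercNearOneGluingNoHeavyLowerTailKnQuestion8CoefficientwiseCoreClassKernelMixIETLayerCake
import HarnessLib

/-!
# Boundary inequality on bundles, XIV: the unconditional TWO-CORNER count and the two-corner IET for ALL monotone real levels

Support file (`--supports stmt-CriticalPhenomena-4575`, closed), prover `prim-cplus-coupling` (gen 57).  No definitions, no notations, no named facts,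
no sorries; standard axioms.  Memo `prim-cplus-coupling/A5-COUPLING-gen56.md` §3.7, `A5-COUPLING-gen57.md` §3/§6.

On an explicit bundle with exactly three threads `t₁, t₂, o` (`t₁ ≠ t₂`), for EVERY up-closed event `𝒱`:
* `Coefficientwise.bundle_two_corner_count'` (0/1 levels, NO hypothesis on the sources): the type-1 sources of `𝒱` with `t₁` blue plus the type-2 sources with
  `t₂` blue are at most the `(L₁ ∪ L₂)`-supply points of `𝒱` — the canonical slab schemes `B₁(t₁)`, `B₂(t₂)` (`bundle_canonical_slab`) have disjoint landing sets
  by the structure clause and the chain lemma.  (`bundle_two_corner_count` is the case in which all sources are of this form.)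
* `Coefficientwise.iet_two_corner_bundle` (ALL monotone real levels `0 ≤ hᵃ, hᵇ ≤ h`, `0 ≤ kᵃ, kᵇ ≤ k`): the increasing-event-transfer functional with its DEMAND
  restricted to the colourings of `𝒱` in which both `t₁` and `t₂` are blue (full supply) is nonnegative:
  `0 ≤ Σ_{ω ∈ 𝒱, b ∈ X∖Y} h(X) k(X) + Σ_{ω ∈ 𝒱, t₁, t₂ blue, b ∈ Y∖X} (hᵃX − hᵇY)(kᵃX − kᵇY)` (layer cake `iet_of_indicator_levels` + `iet01_ge_count`).
[cite: KozmaNitzan2024, Questions 8–9 (§5.5 p. 36) (context); Harris 1960]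
-/

namespace Summit.CriticalPhenomena.PercolationContinuityZ3.Theorems

open Finset Literature.Probability.Percolation

namespace Coefficientwise

variable {ι V : Type*}

open Classical in
/-- **Unconditional two-corner count (three threads, all 0/1 levels).**  `#{type-1 sources of 𝒱 with t₁ blue} + #{type-2 sources of 𝒱 with t₂ blue} ≤
#(L₁ ∪ L₂)(𝒱)` for `t₁ ≠ t₂`.  Memo gen 56 §3.7, gen 57 §3.  [cite: KozmaNitzan2024, Questions 8–9 (§5.5 p. 36) (context); Harris 1960] -/
theorem bundle_two_corner_count' (ends : ι → Sym2 V) (r : ℕ) (L : ℕ → ℕ) (hL : ∀ t, t < r → 1 ≤ L t)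
    (w : ℕ → ℕ → V) (e : ℕ → ℕ → ι) (u b : V)
    (hw0 : ∀ t, t < r → w t 0 = u) (hwL : ∀ t, t < r → w t (L t) = b)
    (harc : ∀ t, t < r → ∀ j, 1 ≤ j → j ≤ L t → ends (e t j) = s(w t (j - 1), w t j))
    (hwinj : ∀ t, t < r → ∀ i j, i ≤ L t → j ≤ L t → w t i = w t j → i = j)
    (hcross : ∀ t t', t < r → t' < r → t ≠ t' → ∀ i j, i ≤ L t → j ≤ L t' → w t i = w t' j → (i = 0 ∧ j = 0) ∨ (i = L t ∧ j = L t'))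
    (A : ℕ → Finset ι) (hA : ∀ t, t < r → ∀ i, i ∈ A t ↔ ∃ j, 1 ≤ j ∧ j ≤ L t ∧ e t j = i)
    (hAdisj : ∀ t t', t < r → t' < r → t ≠ t' → Disjoint (A t) (A t'))
    (E : Finset ι) (hEA : ∀ i, i ∈ E ↔ ∃ t, t < r ∧ i ∈ A t)
    (t₁ t₂ o : ℕ) (ht₁ : t₁ < r) (ht₂ : t₂ < r) (ho : o < r) (h12 : t₁ ≠ t₂) (h1o : t₁ ≠ o) (h2o : t₂ ≠ o)
    (hr3 : ∀ t, t < r → t = t₁ ∨ t = t₂ ∨ t = o)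
    (𝒱 : Finset ι → Prop) (hV : ∀ ⦃s t : Finset ι⦄, s ⊆ t → 𝒱 s → 𝒱 t)
    (ha hb ka kb : Set V → ℝ) (mha : Monotone ha) (mhb : Monotone hb) (mka : Monotone ka) (mkb : Monotone kb)
    (ha01 : ∀ S, ha S = 0 ∨ ha S = 1) (hb01 : ∀ S, hb S = 0 ∨ hb S = 1) (ka01 : ∀ S, ka S = 0 ∨ ka S = 1) (kb01 : ∀ S, kb S = 0 ∨ kb S = 1) :
    ((E.powerset).filter (fun σ => Disjoint (A t₁) σ ∧ 𝒱 σ ∧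
        (b ∈ openCluster (ends '' (↑(E \ σ) : Set ι)) u ∧ b ∉ openCluster (ends '' (↑σ : Set ι)) u) ∧
        (ha (openCluster (ends '' (↑σ : Set ι)) u) = 1 ∧ hb (openCluster (ends '' (↑(E \ σ) : Set ι)) u) = 0) ∧
        (kb (openCluster (ends '' (↑(E \ σ) : Set ι)) u) = 1 ∧ ka (openCluster (ends '' (↑σ : Set ι)) u) = 0))).card
    + ((E.powerset).filter (fun σ => Disjoint (A t₂) σ ∧ 𝒱 σ ∧
        (b ∈ openCluster (ends '' (↑(E \ σ) : Set ι)) u ∧ b ∉ openCluster (ends '' (↑σ : Set ι)) u) ∧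
        (ka (openCluster (ends '' (↑σ : Set ι)) u) = 1 ∧ kb (openCluster (ends '' (↑(E \ σ) : Set ι)) u) = 0) ∧
        (hb (openCluster (ends '' (↑(E \ σ) : Set ι)) u) = 1 ∧ ha (openCluster (ends '' (↑σ : Set ι)) u) = 0))).card
    ≤ ((E.powerset).filter (fun lam => 𝒱 lam ∧
        (b ∈ openCluster (ends '' (↑lam : Set ι)) u ∧ b ∉ openCluster (ends '' (↑(E \ lam) : Set ι)) u) ∧
        ((ha (openCluster (ends '' (↑lam : Set ι)) u) = 1 ∧ kb (openCluster (ends '' (↑lam : Set ι)) u) = 1 ∧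
            hb (openCluster (ends '' (↑(E \ lam) : Set ι)) u) = 0 ∧ ka (openCluster (ends '' (↑(E \ lam) : Set ι)) u) = 0) ∨
          (ka (openCluster (ends '' (↑lam : Set ι)) u) = 1 ∧ hb (openCluster (ends '' (↑lam : Set ι)) u) = 1 ∧
            kb (openCluster (ends '' (↑(E \ lam) : Set ι)) u) = 0 ∧ ha (openCluster (ends '' (↑(E \ lam) : Set ι)) u) = 0)))).card := by
  set C : Finset ι → Set V := fun ω => openCluster (ends '' (↑ω : Set ι)) u with hC
  have hr : 0 < r := lt_of_le_of_lt (Nat.zero_le o) ho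
  have hAE : ∀ t, t < r → A t ⊆ E := fun t ht i hi => (hEA i).mpr ⟨t, ht, hi⟩
  have heA : ∀ t, t < r → ∀ j, 1 ≤ j → j ≤ L t → e t j ∈ A t := fun t ht j hj1 hjL => (hA t ht _).mpr ⟨j, hj1, hjL, rfl⟩
  have hE : ∀ i, i ∈ E → ∃ t, t < r ∧ ∃ j, 1 ≤ j ∧ j ≤ L t ∧ e t j = i := fun i hi => by
    obtain ⟨t, ht, hit⟩ := (hEA i).mp hi; exact ⟨t, ht, (hA t ht i).mp hit⟩
  have full_iff : ∀ ω : Finset ι, ω ⊆ E → (b ∈ C ω ↔ ∃ t, t < r ∧ A t ⊆ ω) := fun ω hω =>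
    bundle_b_mem_cluster_iff_threads ends r L hL w e u b hr hw0 hwL harc hwinj hcross A hA E hEA ω hω
  have one_of_ge : ∀ (f : Set V → ℝ), (∀ S, f S = 0 ∨ f S = 1) → ∀ S S' : Set V, S ⊆ S' → Monotone f → f S = 1 → f S' = 1 :=
    fun f f01 S S' hSS' mf h1 => (f01 S').elim (fun h0 => by have := mf hSS'; rw [h1, h0] at this; linarith) id
  have nofull : ∀ σ : Finset ι, σ ⊆ E → b ∉ C σ → ∀ t, t < r → ∃ j, 1 ≤ j ∧ j ≤ L t ∧ e t j ∉ σ := by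
    intro σ hσ hb' t ht
    by_contra hno
    push Not at hno
    exact hb' ((full_iff σ hσ).mpr ⟨t, ht, fun x hx => by
      obtain ⟨j, hj1, hjL, rfl⟩ := (hA t ht x).mp hx
      exact hno j hj1 hjL⟩)
  have hr3' : ∀ t', t' < r → t' = t₂ ∨ t' = t₁ ∨ t' = o := fun t' ht' => by rcases hr3 t' ht' with h | h | h <;> simp [h]
  obtain ⟨M₁, le₁, mem₁, wit₁⟩ := bundle_canonical_slab ends r L hL w e u b hw0 hwL harc hwinj hcross A hA hAdisj E hEA t₁ t₂ o ht₁ ht₂ ho h12 h1o h2o hr3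
    𝒱 hV ha hb ka kb mha mhb mka mkb ha01 hb01 ka01 kb01
  obtain ⟨M₂, le₂, mem₂, wit₂⟩ := bundle_canonical_slab ends r L hL w e u b hw0 hwL harc hwinj hcross A hA hAdisj E hEA t₂ t₁ o ht₂ ht₁ ho h12.symm h2o h1o hr3'
    𝒱 hV ka kb ha hb mka mkb mha mhb ka01 kb01 ha01 hb01
  -- ## the two landing sets are disjoint (structure clause + chain lemma)
  have hdisj : Disjoint M₁ M₂ := by
    rw [Finset.disjoint_left]
    intro lam h1 h2
    obtain ⟨σ₁, hσ₁E, hd₁, hn₁, hs₁⟩ := wit₁ lam h1 t₂ ht₂ h12.symm (mem₂ lam h2).2.1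
    obtain ⟨σ₂, hσ₂E, hd₂, hn₂, hs₂⟩ := wit₂ lam h2 t₁ ht₁ h12 (mem₁ lam h1).2.1
    have hstart : ∀ σ : Finset ι, e t₁ 1 ∉ σ → e t₂ 1 ∉ σ → ∀ t, t < r → t ≠ o → e t 1 ∉ σ := by
      intro σ hx hy t ht hto hm
      rcases hr3 t ht with h | h | h
      · rw [h] at hm; exact hx hm
      · rw [h] at hm; exact hy hm
      · exact hto h
    have hcmp := bundle_boundary_chain ends r L w e u hw0 harc hwinj hcross E hE o σ₁ σ₂ hσ₁E hσ₂E
      (nofull σ₁ hσ₁E hs₁.2.1.2) (nofull σ₂ hσ₂E hs₂.2.1.2)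
      (hstart σ₁ (fun hm => Finset.disjoint_left.mp hd₁ (heA t₁ ht₁ 1 (le_refl 1) (hL t₁ ht₁)) hm) hn₁)
      (hstart σ₂ hn₂ (fun hm => Finset.disjoint_left.mp hd₂ (heA t₂ ht₂ 1 (le_refl 1) (hL t₂ ht₂)) hm))
    rcases hcmp with hsub | hsub
    · have h0 := hs₂.2.2.2.2
      rw [one_of_ge ha ha01 _ _ hsub mha hs₁.2.2.1.1] at h0; exact one_ne_zero h0
    · have h0 := hs₁.2.2.2.2
      rw [one_of_ge ka ka01 _ _ hsub mka hs₂.2.2.1.1] at h0; exact one_ne_zero h0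
  have hsub : M₁ ∪ M₂ ⊆ (E.powerset).filter (fun lam => 𝒱 lam ∧ (b ∈ C lam ∧ b ∉ C (E \ lam)) ∧
      ((ha (C lam) = 1 ∧ kb (C lam) = 1 ∧ hb (C (E \ lam)) = 0 ∧ ka (C (E \ lam)) = 0) ∨
        (ka (C lam) = 1 ∧ hb (C lam) = 1 ∧ kb (C (E \ lam)) = 0 ∧ ha (C (E \ lam)) = 0))) := by
    intro lam hlam
    rw [Finset.mem_filter, Finset.mem_powerset]
    rcases Finset.mem_union.mp hlam with h | h
    · have m := mem₁ lam h; exact ⟨m.1, hV Finset.sdiff_subset m.2.2.1, m.2.2.2.2.1, Or.inl m.2.2.2.2.2⟩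
    · have m := mem₂ lam h; exact ⟨m.1, hV Finset.sdiff_subset m.2.2.1, m.2.2.2.2.1, Or.inr m.2.2.2.2.2⟩
  have b₁ : ((E.powerset).filter (fun σ => Disjoint (A t₁) σ ∧ 𝒱 σ ∧ (b ∈ C (E \ σ) ∧ b ∉ C σ) ∧ (ha (C σ) = 1 ∧ hb (C (E \ σ)) = 0) ∧
      (kb (C (E \ σ)) = 1 ∧ ka (C σ) = 0))).card ≤ M₁.card := by convert le₁ using 3
  have b₂ : ((E.powerset).filter (fun σ => Disjoint (A t₂) σ ∧ 𝒱 σ ∧ (b ∈ C (E \ σ) ∧ b ∉ C σ) ∧ (ka (C σ) = 1 ∧ kb (C (E \ σ)) = 0) ∧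
      (hb (C (E \ σ)) = 1 ∧ ha (C σ) = 0))).card ≤ M₂.card := by convert le₂ using 3
  have ecard := Finset.card_union_of_disjoint hdisj
  have c1 := Finset.card_le_card hsub
  have b₁' : ((E.powerset).filter (fun σ => Disjoint (A t₁) σ ∧ 𝒱 σ ∧
      (b ∈ openCluster (ends '' (↑(E \ σ) : Set ι)) u ∧ b ∉ openCluster (ends '' (↑σ : Set ι)) u) ∧
      (ha (openCluster (ends '' (↑σ : Set ι)) u) = 1 ∧ hb (openCluster (ends '' (↑(E \ σ) : Set ι)) u) = 0) ∧
      (kb (openCluster (ends '' (↑(E \ σ) : Set ι)) u) = 1 ∧ ka (openCluster (ends '' (↑σ : Set ι)) u) = 0))).card ≤ M₁.card := by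
    convert b₁ using 3
  have b₂' : ((E.powerset).filter (fun σ => Disjoint (A t₂) σ ∧ 𝒱 σ ∧
      (b ∈ openCluster (ends '' (↑(E \ σ) : Set ι)) u ∧ b ∉ openCluster (ends '' (↑σ : Set ι)) u) ∧
      (ka (openCluster (ends '' (↑σ : Set ι)) u) = 1 ∧ kb (openCluster (ends '' (↑(E \ σ) : Set ι)) u) = 0) ∧
      (hb (openCluster (ends '' (↑(E \ σ) : Set ι)) u) = 1 ∧ ha (openCluster (ends '' (↑σ : Set ι)) u) = 0))).card ≤ M₂.card := by
    convert b₂ using 3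
  have c1' : (M₁ ∪ M₂).card ≤ ((E.powerset).filter (fun lam => 𝒱 lam ∧
      (b ∈ openCluster (ends '' (↑lam : Set ι)) u ∧ b ∉ openCluster (ends '' (↑(E \ lam) : Set ι)) u) ∧
      ((ha (openCluster (ends '' (↑lam : Set ι)) u) = 1 ∧ kb (openCluster (ends '' (↑lam : Set ι)) u) = 1 ∧
          hb (openCluster (ends '' (↑(E \ lam) : Set ι)) u) = 0 ∧ ka (openCluster (ends '' (↑(E \ lam) : Set ι)) u) = 0) ∨
        (ka (openCluster (ends '' (↑lam : Set ι)) u) = 1 ∧ hb (openCluster (ends '' (↑lam : Set ι)) u) = 1 ∧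
          kb (openCluster (ends '' (↑(E \ lam) : Set ι)) u) = 0 ∧ ha (openCluster (ends '' (↑(E \ lam) : Set ι)) u) = 0)))).card := by
    convert c1 using 3
  omega

open Classical in
/-- **Two-corner IET on a 3-thread bundle (all monotone real levels).**  See the module docstring: demand restricted to the colourings of `𝒱` with `t₁` and
`t₂` blue, full supply.  [cite: KozmaNitzan2024, Questions 8–9 (§5.5 p. 36) (context); Harris 1960] -/
theorem iet_two_corner_bundle (ends : ι → Sym2 V) (r : ℕ) (L : ℕ → ℕ) (hL : ∀ t, t < r → 1 ≤ L t)
    (w : ℕ → ℕ → V) (e : ℕ → ℕ → ι) (u b : V)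
    (hw0 : ∀ t, t < r → w t 0 = u) (hwL : ∀ t, t < r → w t (L t) = b)
    (harc : ∀ t, t < r → ∀ j, 1 ≤ j → j ≤ L t → ends (e t j) = s(w t (j - 1), w t j))
    (hwinj : ∀ t, t < r → ∀ i j, i ≤ L t → j ≤ L t → w t i = w t j → i = j)
    (hcross : ∀ t t', t < r → t' < r → t ≠ t' → ∀ i j, i ≤ L t → j ≤ L t' → w t i = w t' j → (i = 0 ∧ j = 0) ∨ (i = L t ∧ j = L t'))
    (A : ℕ → Finset ι) (hA : ∀ t, t < r → ∀ i, i ∈ A t ↔ ∃ j, 1 ≤ j ∧ j ≤ L t ∧ e t j = i)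
    (hAdisj : ∀ t t', t < r → t' < r → t ≠ t' → Disjoint (A t) (A t'))
    (E : Finset ι) (hEA : ∀ i, i ∈ E ↔ ∃ t, t < r ∧ i ∈ A t)
    (t₁ t₂ o : ℕ) (ht₁ : t₁ < r) (ht₂ : t₂ < r) (ho : o < r) (h12 : t₁ ≠ t₂) (h1o : t₁ ≠ o) (h2o : t₂ ≠ o)
    (hr3 : ∀ t, t < r → t = t₁ ∨ t = t₂ ∨ t = o)
    (𝒱 : Finset ι → Prop) (hV : ∀ ⦃s t : Finset ι⦄, s ⊆ t → 𝒱 s → 𝒱 t)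
    (h k ha hb ka kb : Set V → ℝ) (mh : Monotone h) (mk : Monotone k)
    (mha : Monotone ha) (mhb : Monotone hb) (mka : Monotone ka) (mkb : Monotone kb)
    (ha0 : ∀ S, 0 ≤ ha S) (hah : ∀ S, ha S ≤ h S) (hb0 : ∀ S, 0 ≤ hb S) (hbh : ∀ S, hb S ≤ h S)
    (ka0 : ∀ S, 0 ≤ ka S) (kak : ∀ S, ka S ≤ k S) (kb0 : ∀ S, 0 ≤ kb S) (kbk : ∀ S, kb S ≤ k S) :
    0 ≤ (∑ ω ∈ E.powerset, if 𝒱 ω ∧ (b ∈ openCluster (ends '' (↑ω : Set ι)) u ∧ b ∉ openCluster (ends '' (↑(E \ ω) : Set ι)) u) then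
        h (openCluster (ends '' (↑ω : Set ι)) u) * k (openCluster (ends '' (↑ω : Set ι)) u) else 0)
      + ∑ ω ∈ E.powerset, if (𝒱 ω ∧ Disjoint (A t₁) ω ∧ Disjoint (A t₂) ω) ∧ (b ∈ openCluster (ends '' (↑(E \ ω) : Set ι)) u ∧
          b ∉ openCluster (ends '' (↑ω : Set ι)) u) then
        (ha (openCluster (ends '' (↑ω : Set ι)) u) - hb (openCluster (ends '' (↑(E \ ω) : Set ι)) u)) *
          (ka (openCluster (ends '' (↑ω : Set ι)) u) - kb (openCluster (ends '' (↑(E \ ω) : Set ι)) u)) else 0 := by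
  set C : Finset ι → Set V := fun ω => openCluster (ends '' (↑ω : Set ι)) u with hC
  refine iet_of_indicator_levels E (fun ω => 𝒱 ω ∧ (b ∈ C ω ∧ b ∉ C (E \ ω)))
    (fun ω => (𝒱 ω ∧ Disjoint (A t₁) ω ∧ Disjoint (A t₂) ω) ∧ (b ∈ C (E \ ω) ∧ b ∉ C ω)) C (fun ω => C (E \ ω)) ?_
    h k ha hb ka kb mh mk mha mhb mka mkb ha0 hah hb0 hbh ka0 kak kb0 kbk
  intro h k ha hb ka kb mh mk mha mhb mka mkb h01 k01 ha01 hb01 ka01 kb01 hah hbh kak kbk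
  have cnt := iet01_ge_count E (fun ω => 𝒱 ω ∧ (b ∈ C ω ∧ b ∉ C (E \ ω)))
    (fun ω => (𝒱 ω ∧ Disjoint (A t₁) ω ∧ Disjoint (A t₂) ω) ∧ (b ∈ C (E \ ω) ∧ b ∉ C ω)) C (fun ω => C (E \ ω)) h k ha hb ka kb h01 k01 ha01 hb01 ka01 kb01
  have tc := bundle_two_corner_count' ends r L hL w e u b hw0 hwL harc hwinj hcross A hA hAdisj E hEA t₁ t₂ o ht₁ ht₂ ho h12 h1o h2o hr3 𝒱 hV
    ha hb ka kb mha mhb mka mkb ha01 hb01 ka01 kb01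
  have up1 : ∀ (f g : Set V → ℝ), (∀ S, g S = 0 ∨ g S = 1) → (∀ S, f S ≤ g S) → ∀ S, f S = 1 → g S = 1 := by
    intro f g g01 hfg S e1
    rcases g01 S with h0 | h0
    · have := hfg S; rw [e1, h0] at this; linarith
    · exact h0
  -- demand-side sums are dominated by the slab source counts
  have d1 : (∑ ω ∈ E.powerset, if ((𝒱 ω ∧ Disjoint (A t₁) ω ∧ Disjoint (A t₂) ω) ∧ (b ∈ C (E \ ω) ∧ b ∉ C ω)) ∧
        ha (C ω) = 1 ∧ kb (C (E \ ω)) = 1 ∧ hb (C (E \ ω)) = 0 ∧ ka (C ω) = 0 then (1 : ℝ) else 0) ≤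
      (((E.powerset).filter (fun σ => Disjoint (A t₁) σ ∧ 𝒱 σ ∧ (b ∈ C (E \ σ) ∧ b ∉ C σ) ∧
        (ha (C σ) = 1 ∧ hb (C (E \ σ)) = 0) ∧ (kb (C (E \ σ)) = 1 ∧ ka (C σ) = 0))).card : ℝ) := by
    rw [Finset.natCast_card_filter]
    refine Finset.sum_le_sum fun ω _ => ?_
    by_cases hP : ((𝒱 ω ∧ Disjoint (A t₁) ω ∧ Disjoint (A t₂) ω) ∧ (b ∈ C (E \ ω) ∧ b ∉ C ω)) ∧
        ha (C ω) = 1 ∧ kb (C (E \ ω)) = 1 ∧ hb (C (E \ ω)) = 0 ∧ ka (C ω) = 0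
    · rw [if_pos hP, if_pos ⟨hP.1.1.2.1, hP.1.1.1, hP.1.2, ⟨hP.2.1, hP.2.2.2.1⟩, ⟨hP.2.2.1, hP.2.2.2.2⟩⟩]
    · rw [if_neg hP]; split_ifs <;> norm_num
  have d2 : (∑ ω ∈ E.powerset, if ((𝒱 ω ∧ Disjoint (A t₁) ω ∧ Disjoint (A t₂) ω) ∧ (b ∈ C (E \ ω) ∧ b ∉ C ω)) ∧
        hb (C (E \ ω)) = 1 ∧ ka (C ω) = 1 ∧ ha (C ω) = 0 ∧ kb (C (E \ ω)) = 0 then (1 : ℝ) else 0) ≤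
      (((E.powerset).filter (fun σ => Disjoint (A t₂) σ ∧ 𝒱 σ ∧ (b ∈ C (E \ σ) ∧ b ∉ C σ) ∧
        (ka (C σ) = 1 ∧ kb (C (E \ σ)) = 0) ∧ (hb (C (E \ σ)) = 1 ∧ ha (C σ) = 0))).card : ℝ) := by
    rw [Finset.natCast_card_filter]
    refine Finset.sum_le_sum fun ω _ => ?_
    by_cases hP : ((𝒱 ω ∧ Disjoint (A t₁) ω ∧ Disjoint (A t₂) ω) ∧ (b ∈ C (E \ ω) ∧ b ∉ C ω)) ∧
        hb (C (E \ ω)) = 1 ∧ ka (C ω) = 1 ∧ ha (C ω) = 0 ∧ kb (C (E \ ω)) = 0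
    · rw [if_pos hP, if_pos ⟨hP.1.1.2.2, hP.1.1.1, hP.1.2, ⟨hP.2.2.1, hP.2.2.2.2⟩, ⟨hP.2.1, hP.2.2.2.1⟩⟩]
    · rw [if_neg hP]; split_ifs <;> norm_num
  have d3 : (0 : ℝ) ≤ ∑ ω ∈ E.powerset, if ((𝒱 ω ∧ Disjoint (A t₁) ω ∧ Disjoint (A t₂) ω) ∧ (b ∈ C (E \ ω) ∧ b ∉ C ω)) ∧
        ha (C ω) = 1 ∧ ka (C ω) = 1 ∧ hb (C (E \ ω)) = 0 ∧ kb (C (E \ ω)) = 0 then (1 : ℝ) else 0 :=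
    Finset.sum_nonneg fun ω _ => by split_ifs <;> norm_num
  -- supply side: L₁ ∪ L₂ ⊆ S
  have s1 : (((E.powerset).filter (fun lam => 𝒱 lam ∧ (b ∈ C lam ∧ b ∉ C (E \ lam)) ∧
      ((ha (C lam) = 1 ∧ kb (C lam) = 1 ∧ hb (C (E \ lam)) = 0 ∧ ka (C (E \ lam)) = 0) ∨
        (ka (C lam) = 1 ∧ hb (C lam) = 1 ∧ kb (C (E \ lam)) = 0 ∧ ha (C (E \ lam)) = 0)))).card : ℝ) ≤
      ∑ ω ∈ E.powerset, if (𝒱 ω ∧ (b ∈ C ω ∧ b ∉ C (E \ ω))) ∧ h (C ω) = 1 ∧ k (C ω) = 1 then (1 : ℝ) else 0 := by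
    rw [Finset.natCast_card_filter]
    refine Finset.sum_le_sum fun ω _ => ?_
    by_cases hP : 𝒱 ω ∧ (b ∈ C ω ∧ b ∉ C (E \ ω)) ∧
        ((ha (C ω) = 1 ∧ kb (C ω) = 1 ∧ hb (C (E \ ω)) = 0 ∧ ka (C (E \ ω)) = 0) ∨
          (ka (C ω) = 1 ∧ hb (C ω) = 1 ∧ kb (C (E \ ω)) = 0 ∧ ha (C (E \ ω)) = 0))
    · have hQ : (𝒱 ω ∧ (b ∈ C ω ∧ b ∉ C (E \ ω))) ∧ h (C ω) = 1 ∧ k (C ω) = 1 := by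
        refine ⟨⟨hP.1, hP.2.1⟩, ?_⟩
        rcases hP.2.2 with hL' | hL'
        · exact ⟨up1 ha h h01 hah _ hL'.1, up1 kb k k01 kbk _ hL'.2.1⟩
        · exact ⟨up1 hb h h01 hbh _ hL'.2.1, up1 ka k k01 kak _ hL'.1⟩
      rw [if_pos hP, if_pos hQ]
    · rw [if_neg hP]; split_ifs <;> norm_num
  have tc' : (((E.powerset).filter (fun σ => Disjoint (A t₁) σ ∧ 𝒱 σ ∧ (b ∈ C (E \ σ) ∧ b ∉ C σ) ∧
        (ha (C σ) = 1 ∧ hb (C (E \ σ)) = 0) ∧ (kb (C (E \ σ)) = 1 ∧ ka (C σ) = 0))).card : ℝ) +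
      (((E.powerset).filter (fun σ => Disjoint (A t₂) σ ∧ 𝒱 σ ∧ (b ∈ C (E \ σ) ∧ b ∉ C σ) ∧
        (ka (C σ) = 1 ∧ kb (C (E \ σ)) = 0) ∧ (hb (C (E \ σ)) = 1 ∧ ha (C σ) = 0))).card : ℝ) ≤
      (((E.powerset).filter (fun lam => 𝒱 lam ∧ (b ∈ C lam ∧ b ∉ C (E \ lam)) ∧
        ((ha (C lam) = 1 ∧ kb (C lam) = 1 ∧ hb (C (E \ lam)) = 0 ∧ ka (C (E \ lam)) = 0) ∨
          (ka (C lam) = 1 ∧ hb (C lam) = 1 ∧ kb (C (E \ lam)) = 0 ∧ ha (C (E \ lam)) = 0)))).card : ℝ) := by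
    have hnat := (Nat.cast_le (α := ℝ)).mpr tc
    rw [Nat.cast_add] at hnat
    convert hnat using 4
  refine le_trans ?_ cnt
  linarith [d1, d2, d3, s1, tc']

end Coefficientwise

end Summit.CriticalPhenomena.PercolationContinuityZ3.Theorems
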